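import Summits.ABC.IUTFork.Repair.RHQ3LTail
import Literature.IUT.LogVolume.LocalDegreeGlobalBounds
import HarnessLib

/-!
# D-0079 RESCUE sub-cell R-H, ROUND 2 Q3 — the l-TAIL of row 3 «hull-capacity-necessary», CONVERSE side and the (C1) window:
# a genuine datum is OUTSIDE Σ₃ as long as one normalised local height exceeds `4·(6 + 2·log_p [K_w : ℚ_p])·l/(l−3)`

Companion of `RHQ3LTail` (seat abc-iut-rh2-q3-typ-1 g0; rung LADDER-ABC:A2.RESCUE.H; rh-lead g2 R13 «l₀(T) vs the admissible l-window»).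
PROOF-ONLY (0 definitions). TAKES NO SIDE on [IUTchIII] Cor. 3.12 or on any author; nothing here asserts abc; H⋆₃ =
`RHHullCapacityNecessaryTyped.HStar` is a HYPOTHESIS about OUR typed objects, consumed BY NAME; «cell fails» = the [ED] engine refutes OUR typed
licence there (`RHHullCapacityNecessaryTyped.not_licence_of_not_cellAt`), never a statement about print.

TWO-SIDED l₀ LAW (with `RHQ3LTail.cellAt_pilotDataOfK_of_ltail`). At a bad place `w | p` (`p > 2`) of `Cor312Prov.pilotDataOfK D K` over `v = w ∩ F`,
write `n = ord_v(q_v)`, `e₀ = e(v|p)`, `H_v = n/e₀` (l-free), `e_w = e₀·e(w|v) ≥ l`, `N_w = [K_w : ℚ_p] ≤ [K : ℚ]`: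
* IN (landed): `p^t ≤ l ∧ n ≤ 4·e₀·(t+1)` ⟹ every cell at `w` holds — roughly `H_v ≤ 4·(log_p l + 1)`;
* OUT (this file): `2·l·e₀·(6 + 2·log_p N_w) ≤ i₀·n` ⟹ the cell at label `i₀+1` FAILS (`not_cellAt_pilotDataOfK_of_heavy`; [IUTchIV] Prop. 1.2/1.3 degree
  bound `d + a + b < 4 + 2·log_p N_w`, `Literature.IUT.LogVolume.depthConstants_lt`, + `c = 1` + the floor unit); at the TOP label `i₀ = l⋆ − 1 = (l−3)/2`:
  `4·l·e₀·(6 + 2·log_p [K:ℚ]) ≤ (l−3)·n` ⟹ `¬ H⋆₃` (`not_hStar_pilotDataOfK_of_heavy_top`) — roughly `H_v ≥ (24 + 8·log_p [K:ℚ])·l/(l−3)`.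
So the tail threshold `l₀(E)` of `RHQ3LTail.LTailSigma3` is PINNED between two exponentials in the largest normalised local height:
`p^{(H_v·(l−3)/l − 24)/8}/[K:ℚ]… ≲ l₀ ≲ p^{⌈H_v/4⌉ − 1}` — exponential in the height carried by one place, on both sides.

VS THE (C1)/(P1) WINDOW of [IUTchIV] Cor. 2.2 (ii) (kernel twin `Literature.IUT.LogVolume.Cor22.Data.P1lo : s ≤ l`, `P1hi : l ≤ 10δ·s·log(2δ·s²)`,
`s = h^{1/2}`; rp-lit 21:41:35Z): `hStar_pilotDataOfK_of_le_window` — if the curve's per-place thresholds sit below the window BOTTOM (`p_v^{t_v} ≤ s ≤ l`),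
the WHOLE admissible window lies inside Σ₃; conversely inside the window `[K:ℚ] ≤ [F:ℚ]·#GL₂(𝔽_l)`, so `log_p [K:ℚ] = O(log l)` and every datum with
`H_v ≳ 24 + 8·log_p[F:ℚ] + 32·log_p l` at one bad place is OUTSIDE Σ₃ at that `l` (numerics of record: rh2-q3-num 22:08:05Z, HEX `l₀⁸(k) ≈ 2^{[k odd]}·7^{⌊k/2⌋}/e_v`,
compatible with (P1) iff `k ≤ 23`). [cite: Mochizuki2012, IUTchI Def. 3.1 (c) p. 62, Ex. 3.2 (iv) p. 71; IUTchIV Prop. 1.2 p. 10, Prop. 1.3 p. 12, Cor. 2.2 (ii) p. 45]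
[cite: NeukirchANT1999, Ch. II Prop. (6.8)] [claim: Mochizuki2012, status: disputed] for every IUT locution.
-/

noncomputable section

open Set Function NumberField IsDedekindDomain Module

namespace Summit.ABC.IUTFork.Repair.RH.Q3LTail

open Literature.IUT.LogThetaLattice Literature.IUT.LogVolume Literature.IUT.HodgeTheaters
open Summit.ABC.IUTFork.Thm311 Summit.ABC.IUTFork.Thm311.Real Summit.ABC.IUTFork.Cor312Prov
  Summit.ABC.IUTFork.Repair.RHHullCapacityNecessaryTyped

variable {F K Fbar : Type} [Field F] [NumberField F] [Field K] [NumberField K] [Algebra F K] [Field Fbar]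
  [Algebra F Fbar] [Algebra K Fbar] {E : WeierstrassCurve F} [E.IsElliptic] {l : ℕ} {Pb : BadPlacePredicates K}
  (D : InitialThetaData F K Fbar E l Pb) {logv : PadicLogs K} (hlog : LogvAnalytic logv)

/-- **ROW 3, CONVERSE (OUT) SIDE AT A GENUINE CELL.** At a bad place `w | p`, `p > 2`, of `pilotDataOfK D K` over `v`: if the label index `i₀` satisfies
`2·l·e(v|p)·(6 + 2·log_p [K_w:ℚ_p]) ≤ i₀·ord_v(q_v)`, then H⋆₃'s cell at `(i₀+1, w)` FAILS. Proof: `(j−1)·μ = i₀·ord_v(q_v)/(2l·e(v|p))`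
(`exists_nat_qPilot_pilotDataOfK`, tower `e_w = e(v|p)·e(w|v)`) and `d + a + b + c + 1 < 6 + 2·log_p [K_w:ℚ_p]` (`depthConstants_lt`, `c = 1`), then
`RHQ3LTail.not_cellAt_of_linear`. [cite: Mochizuki2012, IUTchIV Prop. 1.2 p. 10, Prop. 1.3 p. 12] [claim: Mochizuki2012, status: disputed] -/
theorem not_cellAt_pilotDataOfK_of_heavy (pp : Nat.Primes) (hp2 : 2 < (pp : ℕ)) (i₀ : Fin (thetaIndex (pilotDataOfK D K)).lstar)
    (w : (thetaIndex (pilotDataOfK D K)).Fibre (.inr pp))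
    (hw : haveI : Fact (pp : ℕ).Prime := ⟨pp.2⟩; placeOf (pilotDataOfK D K) pp.1 w ∈ (pilotDataOfK D K).S)
    (h : haveI : Fact (pp : ℕ).Prime := ⟨pp.2⟩
      2 * (l : ℝ) * ramIdx F (finBelow F K (placeOf (pilotDataOfK D K) pp.1 w)) *
          (6 + 2 * Real.logb (pp : ℕ) (finrank ℚ_[pp] (kOf (pilotDataOfK D K) pp.1 w))) ≤
        (i₀ : ℕ) * (qParamOrd E (finBelow F K (placeOf (pilotDataOfK D K) pp.1 w)) : ℝ)) :
    ¬ CellAt (pilotDataOfK D K) hlog pp i₀ w := by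
  haveI hF : Fact (pp : ℕ).Prime := ⟨pp.2⟩
  set w₀ := placeOf (pilotDataOfK D K) pp.1 w with hw₀
  set v := finBelow F K w₀ with hv
  obtain ⟨P, hP, -, h2lP⟩ := exists_nat_qPilot_pilotDataOfK D hw
  have htower : w₀.asIdeal.ramificationIdx ℤ = ramIdx F v * Ideal.ramificationIdx' v.asIdeal w₀.asIdeal :=
    ThetaData.absRamificationIdx_eq_ramIdx_mul (F := F) w₀
  have hVF : FinitePlace.mk v ∈ D.VFbad := (mem_pilotDataOfK_S_iff D K w₀).mp hw
  have hlr : l ≤ Ideal.ramificationIdx' v.asIdeal w₀.asIdeal := ThetaData.l_le_ramificationIdx_of_under_mem_VFbad D hVF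
  have he0 : 0 < ramIdx F v := Nat.pos_of_ne_zero (ramIdx_ne_zero F v)
  have h5 : 5 ≤ l := D.five_le_l
  have hr0 : 0 < Ideal.ramificationIdx' v.asIdeal w₀.asIdeal := lt_of_lt_of_le (by omega) hlr
  -- the depth constants are below `5 + 2·log_p N_w` (`c = 1` at odd `p`)
  have hconst := depthConstants_lt (pp : ℕ) (kOf (pilotDataOfK D K) pp.1 w) hp2
  have hc : (((if (pp : ℕ) = 2 then 2 else 1 : ℕ)) : ℝ) = 1 := by
    rw [if_neg (by omega)]; norm_num
  apply not_cellAt_of_linear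
  rw [hc, hP, ramIdx_eq K w₀]
  -- `i₀ · P / e_w = i₀ · n / (2 l e₀)`
  have h2lPR : 2 * (l : ℝ) * (P : ℝ) = (Ideal.ramificationIdx' v.asIdeal w₀.asIdeal : ℝ) * (qParamOrd E v : ℝ) := by
    exact_mod_cast h2lP
  have htR : (w₀.asIdeal.ramificationIdx ℤ : ℝ) = (ramIdx F v : ℝ) * (Ideal.ramificationIdx' v.asIdeal w₀.asIdeal : ℝ) := by
    exact_mod_cast htower
  have he0R : (0 : ℝ) < ramIdx F v := by exact_mod_cast he0
  have hr0R : (0 : ℝ) < (Ideal.ramificationIdx' v.asIdeal w₀.asIdeal : ℝ) := by exact_mod_cast hr0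
  have hlR : (0 : ℝ) < l := by exact_mod_cast (show 0 < l by omega)
  have hi0 : (0 : ℝ) ≤ (i₀ : ℕ) := Nat.cast_nonneg _
  have hμ : ((i₀ : ℕ) : ℝ) * ((P : ℝ) / (w₀.asIdeal.ramificationIdx ℤ : ℝ)) =
      ((i₀ : ℕ) : ℝ) * (qParamOrd E v : ℝ) / (2 * (l : ℝ) * ramIdx F v) := by
    rw [htR]
    field_simp
    nlinarith [h2lPR]
  rw [hμ, le_div_iff₀ (by positivity)]
  nlinarith [hconst, mul_le_mul_of_nonneg_left hconst.le (by positivity : (0 : ℝ) ≤ 2 * (l : ℝ) * ramIdx F v)]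

/-- **ROW 3, CONVERSE AT THE TOP LABEL `j = l⋆` (`i₀ = (l−3)/2`), GLOBAL-DEGREE FORM**: at a bad place `w | p`, `p > 2`, if
`4·l·e(v|p)·(6 + 2·log_p [K:ℚ]) ≤ (l − 3)·ord_v(q_v)` then `¬ H⋆₃ (pilotDataOfK D K)` — the datum is OUTSIDE Σ₃ at this `l` (`[K_w:ℚ_p] ≤ [K:ℚ]`,
`finrank_rescaledCompletion_le_finrank_rat`). With `cellAt_pilotDataOfK_of_ltail` this pins `l₀(E)` between two exponentials in `H_v = ord_v(q_v)/e(v|p)`.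
[cite: Mochizuki2012, IUTchI Def. 3.1 (c) p. 62; IUTchIV Prop. 1.2 p. 10, Prop. 1.3 p. 12] [cite: NeukirchANT1999, Ch. II Prop. (6.8)] [claim: Mochizuki2012, status: disputed] -/
theorem not_hStar_pilotDataOfK_of_heavy_top (pp : Nat.Primes) (hp2 : 2 < (pp : ℕ)) (w : (thetaIndex (pilotDataOfK D K)).Fibre (.inr pp))
    (hw : haveI : Fact (pp : ℕ).Prime := ⟨pp.2⟩; placeOf (pilotDataOfK D K) pp.1 w ∈ (pilotDataOfK D K).S)
    (h : haveI : Fact (pp : ℕ).Prime := ⟨pp.2⟩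
      4 * (l : ℝ) * ramIdx F (finBelow F K (placeOf (pilotDataOfK D K) pp.1 w)) * (6 + 2 * Real.logb (pp : ℕ) (finrank ℚ K)) ≤
        ((l : ℝ) - 3) * (qParamOrd E (finBelow F K (placeOf (pilotDataOfK D K) pp.1 w)) : ℝ)) :
    ¬ HStar (pilotDataOfK D K) hlog := by
  haveI hF : Fact (pp : ℕ).Prime := ⟨pp.2⟩
  have h5 : 5 ≤ l := D.five_le_l
  have hodd : ¬ 2 ∣ l := by
    intro h2
    have := (Nat.prime_dvd_prime_iff_eq Nat.prime_two D.l_prime).mp h2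
    omega
  have hls : (pilotDataOfK D K).lstar = (l - 1) / 2 := by
    unfold PilotData.lstar
    rw [pilotDataOfK_l]
  -- the top label index `i₀ = l⋆ − 1 = (l − 3)/2`
  set i₀ : Fin (thetaIndex (pilotDataOfK D K)).lstar := ⟨(l - 3) / 2, by
    show (l - 3) / 2 < (pilotDataOfK D K).lstar
    rw [hls]; omega⟩ with hi₀
  have hi₀R : (((i₀ : ℕ) : ℝ)) = ((l : ℝ) - 3) / 2 := by
    have h2i : 2 * ((l - 3) / 2) = l - 3 := by omega
    have : (2 : ℝ) * (((l - 3) / 2 : ℕ) : ℝ) = (l : ℝ) - 3 := by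
      have h3 : ((l - 3 : ℕ) : ℝ) = (l : ℝ) - 3 := by
        rw [Nat.cast_sub (by omega)]; norm_num
      rw [← h3]; exact_mod_cast h2i
    show (((l - 3) / 2 : ℕ) : ℝ) = _
    linarith
  intro hH
  refine not_cellAt_pilotDataOfK_of_heavy D hlog pp hp2 i₀ w hw ?_ (hH pp w hw i₀)
  -- `log_p [K_w:ℚ_p] ≤ log_p [K:ℚ]`
  have hpR : (1 : ℝ) < ((pp : ℕ) : ℝ) := by exact_mod_cast pp.2.one_lt
  have hNle : (finrank ℚ_[pp] (kOf (pilotDataOfK D K) pp.1 w) : ℝ) ≤ (finrank ℚ K : ℝ) := by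
    exact_mod_cast finrank_rescaledCompletion_le_finrank_rat K (pp : ℕ) (placeOf (pilotDataOfK D K) pp.1 w)
      (natCast_mem_placeOf (pilotDataOfK D K) pp.1 w)
  have hNpos : (0 : ℝ) < (finrank ℚ_[pp] (kOf (pilotDataOfK D K) pp.1 w) : ℝ) := by
    exact_mod_cast finrank_rescaledCompletion_pos K (pp : ℕ) (placeOf (pilotDataOfK D K) pp.1 w)
      (natCast_mem_placeOf (pilotDataOfK D K) pp.1 w)
  have hlogb : Real.logb (pp : ℕ) (finrank ℚ_[pp] (kOf (pilotDataOfK D K) pp.1 w)) ≤ Real.logb (pp : ℕ) (finrank ℚ K) :=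
    Real.logb_le_logb_of_le hpR hNpos hNle
  have he0R : (0 : ℝ) ≤ ramIdx F (finBelow F K (placeOf (pilotDataOfK D K) pp.1 w)) := Nat.cast_nonneg _
  have hlR : (0 : ℝ) ≤ l := Nat.cast_nonneg _
  rw [hi₀R]
  have hmono : 2 * (l : ℝ) * ramIdx F (finBelow F K (placeOf (pilotDataOfK D K) pp.1 w)) *
      (6 + 2 * Real.logb (pp : ℕ) (finrank ℚ_[pp] (kOf (pilotDataOfK D K) pp.1 w))) ≤
      2 * (l : ℝ) * ramIdx F (finBelow F K (placeOf (pilotDataOfK D K) pp.1 w)) * (6 + 2 * Real.logb (pp : ℕ) (finrank ℚ K)) :=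
    mul_le_mul_of_nonneg_left (by linarith) (by positivity)
  linarith

/-- **IN THE WHOLE (P1) WINDOW.** If the curve's per-place l-tail thresholds sit below a bound `s ≤ l` — `p_v^{t_v} ≤ s` and
`ord_v(q_v) ≤ 4·e(v|p)·(t_v+1)` at every bad place — then `H⋆₃ (pilotDataOfK D K)` at EVERY level `l ≥ s`; read with `s := ⌈h^{1/2}⌉` = the lower
end `Cor22.Data.P1lo : s ≤ l` of [IUTchIV] Cor. 2.2 (ii) (P1)/(C1) (kernel twin `Literature.IUT.LogVolume.Cor22.Data`), this says: the ENTIRE admissible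
window of such a curve lies inside Σ₃. [cite: Mochizuki2012, IUTchIV Cor. 2.2 (ii) (C1) p. 42, (P1) p. 45] [claim: Mochizuki2012, status: disputed] -/
theorem hStar_pilotDataOfK_of_le_window (s : ℕ) (hs : s ≤ l)
    (h : ∀ (pp : Nat.Primes) (w : (thetaIndex (pilotDataOfK D K)).Fibre (.inr pp)),
      haveI : Fact (pp : ℕ).Prime := ⟨pp.2⟩
      placeOf (pilotDataOfK D K) pp.1 w ∈ (pilotDataOfK D K).S →
        ∃ t : ℕ, (pp : ℕ) ^ t ≤ s ∧
          qParamOrd E (finBelow F K (placeOf (pilotDataOfK D K) pp.1 w)) ≤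
            4 * ramIdx F (finBelow F K (placeOf (pilotDataOfK D K) pp.1 w)) * (t + 1)) :
    HStar (pilotDataOfK D K) hlog :=
  hStar_pilotDataOfK_of_ltail D hlog fun pp w hw =>
    let ⟨t, hts, hn⟩ := h pp w hw
    ⟨t, hts.trans hs, hn⟩

end Summit.ABC.IUTFork.Repair.RH.Q3LTail

end
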